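import Mathlib
import Summits.QuantumFields.BalabanUV.Beta.AnalyticWalkSum216Monomial

/-!
# [Balaban1988RG2Cluster] p. 13 «The operator G̃₃(x) has the same properties as G̃₂, especially it can be expanded into a
# generalized random walk expansion» ∕ (2.16) p. 16: the ALGEBRA of walk-term families — the per-term data that the (T1)
# reduction `AnalyticWalkSum216` consumes (termwise σ-analyticity, σ-uniform entrywise majorants, localised row sums with
# summable constants) is CLOSED under re-indexing, sums, bounded scalar multiples and PRODUCTS of families, and monomial
# decorations compose (cell topic `Summits/QuantumFields/BalabanUV/Beta`; row-D4 leaf A.3′ rider (ρ3) ∕ A.4.6, census §10)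

HONEST FRAMING (cell rule).  Discharging `BetaPertH` makes Bałaban's UV stability UNCONDITIONAL — a real
constructive-QFT result; NOT the continuum limit, NOT the Clay problem.  This module discharges NOTHING of `BetaPertH`.
It is [folklore] bookkeeping (Cauchy products of absolutely convergent series, the triangle inequality for the walk
distance) placed at the seam named in the row-D4 owner's `OUTLINE-D4-NODE-A.md` §3b as rider (ρ3) of route A.3′ and as
leaf A.4.6: every operator that the terminal leaves (T2) G-IF-10 ∕ (T3) G-B9-10 hand to [II]'s (2.14)–(2.17) is built from
expanded operators by PRODUCTS, sums, scalar multiples and Neumann series (B9 (3.138) `G₁ = Σ_n G₀((Δ′_π + Δ^{(2)}_π)G₀)ⁿ`;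
the Woodbury recombination `G₃(x) = G₂ − x·G₂Q̂*(1 + xK)⁻¹Q̂G₂` of route A.3′), and (T1) consumes the result as ONE
walk-term family with termwise data (`AnalyticWalkSum216.wrs_termSum_sub_of_termwise`,
`AnalyticWalkSum216Monomial.wrs_termSum_sub_monomial`).  This file proves that such data are stable under the first four
operations, with explicit constants (`Σρ` adds under sums, multiplies under products, scales by `X` under scalars of
modulus `≤ X` — whence x-UNIFORMITY on a compact x-range); the sibling `AnalyticWalkSum216Neumann` does the Neumann
series and the recombination END.  Records-level: NO class change on (T2)∕(T3) (the term data of Bałaban's `G₂` and of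
the unit-lattice inverse are the located open inputs — NODE O.2 + (T3), and d4-p3's `UnitLatticeWalkInversion` with its
U-localisation refinement); NOT summit progress.  Unit `b2b-balaban-beta-an4-g37` (owner of `BINDER-OWNERS.md` row D4);
cell `GAPS.md` C-an4-87.

CITATION HEADER (lean-in-tree rule).  [II] = T. Bałaban, *Renormalization group approach to lattice gauge field theories.
II. Cluster expansions*, Commun. Math. Phys. **116**, 1–22 (1988) [Balaban1988RG2Cluster] (journal page = PDF page;
renders `HOME/b2b-balaban-ref1/pages/1988-cmp116-rg-II-cluster/…-p003∕p013∕p016-x2.png` READ AS IMAGES by this lineage,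
gens 32–36).  p. 3 [PDF 3], verbatim: *"A propagator is represented by the sum (3.107) [13]
Σ_ω R₀(X₀)R_{α₁}(X₁)⋯R_{αₙ}(Xₙ), (1.6)"*; p. 13 [PDF 13], verbatim: *"The operator G̃₃(x) has the same properties as
G̃₂, especially it can be expanded into a generalized random walk expansion. This yields an expansion of the integral
above, hence an expansion of (C^{(k)})^{1/2} also."*; p. 16 [PDF 16], verbatim: *"|R₁(b, b′)| ≦ (O(1)e^{−1∕3δ₀M} +
O(α₀ + α₁))exp(−½δ₀|b₋ − b′₋|). (2.16)"*.  [13] = T. Bałaban, *Propagators for lattice gauge theories in a background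
field*, Commun. Math. Phys. **99**, 389–434 (1985) [Balaban1985BackgroundPropagators], p. 432 [PDF 44], verbatim: *"This
way we can express C^{(k)}(Λ) in terms of the operators of the type G′, (Q′G′²Q′*)⁻¹, G, (QGQ*)⁻¹. Expanding these into
random walks we get a random walk expansion of C^{(k)}(Λ)."*  Nothing of [II]∕[13] is asserted: the sentences LOCATE the
operations (products of expanded operators are expanded operators) whose bookkeeping is certified here on hypothesis-
families.

WHAT IS CERTIFIED HERE (kernel, sorry-free; [folklore]; `n` a finite index type, `W`, `V` ANY index types of walks,
one complex coordinate `σ` on the disc `‖σ‖ < R`, weight `e^{κ d}` with `WeightHyp κ d`).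
§1 `TermData κ d R T m ρw` — the four termwise hypotheses of `AnalyticWalkSum216.wrs_termSum_sub_of_termwise` bundled
   (analyticity, majorant, localised row sums `≤ ρ_w`, `Summable ρ_w`); DERIVED: `m ≥ 0`, `m_w(i,j) ≤ ρ_w`, the entrywise
   summability `hsum` (so the consumer's fifth hypothesis is automatic), `summable_norm`, and the consumer ENDs BY NAME
   (`wrs_termSum`, `wrs_termSum_sub`).
§2 CLOSURE: `reindex` (any `Equiv` of walk types; `termSum` unchanged), `sum` (index `W ⊕ V`, `termSum` adds,
   `Σρ` adds), `smul` (a scalar of modulus `≤ X`: majorant and constants scale by `X` — the x-uniform form), and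
   **`prod`** (index `W × V`, term `T_w(σ)·S_v(σ)`, majorant `Σ_k m_w(i,k)m′_v(k,j)`, constant `ρ_w ρ′_v` by the triangle
   inequality for `d` — the mechanism of `B13PerturbativeStep.wrs_mul_le` on the majorants; `Σ_{(w,v)} ρ_wρ′_v =
   (Σρ)(Σρ′)`), with **`termSum_prod`**: `termSum (prodTerm T S) σ = termSum T σ * termSum S σ` on the disc (Cauchy
   product of absolutely convergent entrywise series, Mathlib `tsum_mul_tsum_of_summable_norm`).
§3 `prodTerm_monoTerm`: products of MONOMIALLY decorated terms are monomially decorated, degrees adding ([II] p. 13).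
NOT CLAIMED.  Any walk expansion of Bałaban's operators or any majorant thereof ((3.108) [13], (1.7)∕(1.11) [II]); the
U-LOCALISATION content of «generalized random walk expansion» (`DecouplingSupportWalks110`'s `BlockLocal` interface; not
modelled here); Neumann series (sibling); multi-parameter analyticity.  NO class change on any GAPS row.
v1.0.1 (DOCSTRING-ONLY over v1 = p213336; declarations byte-identical): CURRENCY CAVEAT — the termwise constants
(`Σ_w ρ_w ≤ ρ`) are VOLUME-DEPENDENT on translation-covariant families; the volume-free twin is `AnalyticWalkSum216RowData`
∕`RowNeumann` (`RowData` = the hypotheses of `wrs_termSum_sub`; `rowData_of_termData`) — XREAD C-an4-89 (f), census §10.23.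
PRIOR ART IN THE TREE (searched 2026-08-20; nothing re-derived): `AnalyticWalkSum216(Monomial)` (an4: the consumer — its
hypotheses are this file's `TermData`); `B13PerturbativeStep.WRS.mul` (the same triangle-inequality mechanism for ONE
operator's row sums — here termwise, keeping the term structure); `B9SectDWalk` (r1-g8: chains of walk terms over REAL
block-normed spaces, no complex parameter — a different currency); `UnitLatticeWalkInversion` (d4-p3: walk inversion of
`1 + K′` in the `WRS` algebra — a future INPUT family here); `DecayingKernelNeumann` (an4 gen 36: decay currency only).
-/

namespace Summit.QuantumFields.BalabanUV.Beta.AnalyticWalkSum216Algebra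

open Metric Set
open Literature.MathematicalPhysics.QuantumFieldTheory.Balaban1983to89
open B13PerturbativeStep (WRS WeightHyp)
open Summit.QuantumFields.BalabanUV.Beta.AnalyticWalkSum216 (termSum majSum norm_termSum_le
  majSum_row_le_of_termwise wrs_termSum_sub_of_termwise)
open Summit.QuantumFields.BalabanUV.Beta.AnalyticWalkSum216Monomial (monoTerm)

noncomputable section

variable {n : Type*} [Fintype n] {W V : Type*} {κ : ℝ} {d : n → n → ℝ} {R : ℝ}

/-! ## §1 The term data of a walk-term family, and what follows from it -/

/-- **TERM DATA** of a walk-term family `T : W → ℂ → Matrix n n ℂ` on the disc `‖σ‖ < R`, at rate `κ` for the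
pseudo-metric `d`: termwise analyticity in `σ`, a `σ`-uniform entrywise majorant `m_w`, localised row sums
`Σ_j m_w(i,j)e^{κ d(i,j)} ≤ ρ_w`, and summable constants `ρ_w` — exactly the termwise hypotheses of
`AnalyticWalkSum216.wrs_termSum_sub_of_termwise` (its entrywise summability hypothesis is DERIVED, `TermData.hsum`).
For a (3.108)-type expansion `ρ_w` is geometric in `|ω|`. [folklore] -/
structure TermData (κ : ℝ) (d : n → n → ℝ) (R : ℝ) (T : W → ℂ → Matrix n n ℂ) (m : W → n → n → ℝ)
    (ρw : W → ℝ) : Prop where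
  /-- (i) termwise analyticity on the disc. -/
  ha : ∀ w i j, DifferentiableOn ℂ (fun σ => T w σ i j) (ball 0 R)
  /-- (ii) the `σ`-uniform entrywise majorant. -/
  hm : ∀ w, ∀ σ ∈ ball (0 : ℂ) R, ∀ i j, ‖T w σ i j‖ ≤ m w i j
  /-- (iii) termwise localised row sums. -/
  hrow : ∀ w i, ∑ j, m w i j * Real.exp (κ * d i j) ≤ ρw w
  /-- (iv) summable constants. -/
  hρw : Summable ρw

namespace TermData

variable {T : W → ℂ → Matrix n n ℂ} {m : W → n → n → ℝ} {ρw : W → ℝ}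

/-- The majorant is nonnegative (the disc is inhabited). [folklore] -/
theorem m_nonneg (h : TermData κ d R T m ρw) (hR : 0 < R) (w : W) (i j : n) : 0 ≤ m w i j :=
  (norm_nonneg _).trans (h.hm w 0 (mem_ball_self hR) i j)

/-- One entry of the majorant is bounded by the localisation constant (weights `≥ 1`). [folklore] -/
theorem m_le (h : TermData κ d R T m ρw) (hw : WeightHyp κ d) (hR : 0 < R) (w : W) (i j : n) :
    m w i j ≤ ρw w := by
  calc m w i j ≤ m w i j * Real.exp (κ * d i j) :=
        le_mul_of_one_le_right (h.m_nonneg hR w i j)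
          (Real.one_le_exp (mul_nonneg hw.κ_nonneg (hw.nonneg i j)))
    _ ≤ ∑ j', m w i j' * Real.exp (κ * d i j') :=
        Finset.single_le_sum (f := fun j' => m w i j' * Real.exp (κ * d i j'))
          (fun j' _ => mul_nonneg (h.m_nonneg hR w i j') (Real.exp_pos _).le) (Finset.mem_univ j)
    _ ≤ ρw w := h.hrow w i

/-- The localisation constants are nonnegative (bonds exist). [folklore] -/
theorem ρw_nonneg [Nonempty n] (h : TermData κ d R T m ρw) (hR : 0 < R) (w : W) :
    0 ≤ ρw w := by
  obtain ⟨i⟩ := ‹Nonempty n›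
  exact (Finset.sum_nonneg fun j _ => mul_nonneg (h.m_nonneg hR w i j) (Real.exp_pos _).le).trans
    (h.hrow w i)

/-- **The consumer's fifth hypothesis is automatic**: the majorants are summable entrywise (comparison with `ρ_w`).
[folklore] -/
theorem hsum (h : TermData κ d R T m ρw) (hw : WeightHyp κ d) (hR : 0 < R) (i j : n) :
    Summable fun w => m w i j :=
  .of_nonneg_of_le (fun w => h.m_nonneg hR w i j) (fun w => h.m_le hw hR w i j) h.hρw

/-- Absolute summability of the entrywise walk sums on the disc. [folklore] -/
theorem summable_norm (h : TermData κ d R T m ρw) (hw : WeightHyp κ d) (hR : 0 < R) {σ : ℂ}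
    (hσ : σ ∈ ball (0 : ℂ) R) (i j : n) : Summable fun w => ‖T w σ i j‖ :=
  .of_nonneg_of_le (fun _ => norm_nonneg _) (fun w => h.hm w σ hσ i j) (h.hsum hw hR i j)

/-- Summability of the entrywise walk sums on the disc. [folklore] -/
theorem summable (h : TermData κ d R T m ρw) (hw : WeightHyp κ d) (hR : 0 < R) {σ : ℂ}
    (hσ : σ ∈ ball (0 : ℂ) R) (i j : n) : Summable fun w => T w σ i j :=
  (h.summable_norm hw hR hσ i j).of_norm

/-- The norms of the constants are summable (they are nonnegative reals). [folklore] -/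
theorem summable_norm_ρw [Nonempty n] (h : TermData κ d R T m ρw) (hR : 0 < R) :
    Summable fun w => ‖ρw w‖ :=
  h.hρw.congr fun w => (Real.norm_of_nonneg (h.ρw_nonneg hR w)).symm

/-- The sum of the constants is nonnegative. [folklore] -/
theorem tsum_ρw_nonneg [Nonempty n] (h : TermData κ d R T m ρw) (hR : 0 < R) :
    0 ≤ ∑' w, ρw w :=
  tsum_nonneg fun w => h.ρw_nonneg hR w

/-- **END (2.16)-shape at every point of the disc**: `WRS κ d (termSum T σ) ρ` whenever `Σ_w ρ_w ≤ ρ`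
(`norm_termSum_le` + `majSum_row_le_of_termwise` BY NAME). [cite: Balaban1988RG2Cluster, (2.16) p.16] -/
theorem wrs_termSum (h : TermData κ d R T m ρw) (hw : WeightHyp κ d) (hR : 0 < R) {ρ : ℝ}
    (hρ : ∑' w, ρw w ≤ ρ) {σ : ℂ} (hσ : σ ∈ ball (0 : ℂ) R) : WRS κ d (termSum T σ) ρ :=
  B13PerturbativeStep.WRS.of_majorant (fun i j => norm_termSum_le h.hm (h.hsum hw hR) hσ i j)
    (majSum_row_le_of_termwise (h.hsum hw hR) h.hrow h.hρw hρ)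

/-- **END (2.16)-shape for the difference**: `WRS κ d (termSum T σ − termSum T 0) (2ρ/R·‖σ‖)`
(`wrs_termSum_sub_of_termwise` BY NAME). [cite: Balaban1988RG2Cluster, (2.16) p.16] -/
theorem wrs_termSum_sub (h : TermData κ d R T m ρw) (hw : WeightHyp κ d) (hR : 0 < R) {ρ : ℝ}
    (hρ : ∑' w, ρw w ≤ ρ) {σ : ℂ} (hσ : σ ∈ ball (0 : ℂ) R) :
    WRS κ d (termSum T σ - termSum T 0) (2 * ρ / R * ‖σ‖) :=
  wrs_termSum_sub_of_termwise hR h.ha h.hm (h.hsum hw hR) h.hrow h.hρw hρ hσ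

end TermData

/-! ## §2 Closure: re-indexing, sums, scalar multiples, products -/

section Reindex

variable {T : W → ℂ → Matrix n n ℂ} {m : W → n → n → ℝ} {ρw : W → ℝ}

/-- **Re-indexing** along an equivalence of walk types preserves the term data. [folklore] -/
theorem TermData.reindex (h : TermData κ d R T m ρw) (e : V ≃ W) :
    TermData κ d R (fun v => T (e v)) (fun v => m (e v)) (fun v => ρw (e v)) where
  ha v := h.ha (e v)
  hm v := h.hm (e v)
  hrow v := h.hrow (e v)
  hρw := (e.summable_iff (f := ρw)).2 h.hρw

omit [Fintype n] in
/-- Re-indexing does not change the summed operator. [folklore] -/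
theorem termSum_reindex (T : W → ℂ → Matrix n n ℂ) (e : V ≃ W) (σ : ℂ) :
    termSum (fun v => T (e v)) σ = termSum T σ := by
  ext i j
  exact e.tsum_eq fun w => T w σ i j

end Reindex

section SumFamily

variable {T : W → ℂ → Matrix n n ℂ} {m : W → n → n → ℝ} {ρw : W → ℝ}
  {S : V → ℂ → Matrix n n ℂ} {m' : V → n → n → ℝ} {ρv : V → ℝ}

/-- **Sum of two families** (index `W ⊕ V`): the term data of `Sum.elim T S`. [folklore] -/
theorem TermData.sum (hT : TermData κ d R T m ρw) (hS : TermData κ d R S m' ρv) :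
    TermData κ d R (Sum.elim T S) (Sum.elim m m') (Sum.elim ρw ρv) where
  ha := by rintro (w | v) i j <;> simp only [Sum.elim_inl, Sum.elim_inr] <;> first | exact hT.ha w i j | exact hS.ha v i j
  hm := by rintro (w | v) σ hσ i j <;> simp only [Sum.elim_inl, Sum.elim_inr] <;>
    first | exact hT.hm w σ hσ i j | exact hS.hm v σ hσ i j
  hrow := by rintro (w | v) i <;> simp only [Sum.elim_inl, Sum.elim_inr] <;>
    first | exact hT.hrow w i | exact hS.hrow v i
  hρw := Summable.sum _ (by simpa only [Sum.elim_comp_inl] using hT.hρw)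
    (by simpa only [Sum.elim_comp_inr] using hS.hρw)

/-- The summed operator of the sum family is the sum of the summed operators (on the disc). [folklore] -/
theorem termSum_sum (hT : TermData κ d R T m ρw) (hS : TermData κ d R S m' ρv) (hw : WeightHyp κ d)
    (hR : 0 < R) {σ : ℂ} (hσ : σ ∈ ball (0 : ℂ) R) :
    termSum (Sum.elim T S) σ = termSum T σ + termSum S σ := by
  ext i j
  simp only [termSum, Matrix.add_apply]
  have h1 : Summable ((fun x : W ⊕ V => Sum.elim T S x σ i j) ∘ Sum.inl) := by
    simpa only [Function.comp_def, Sum.elim_inl] using hT.summable hw hR hσ i j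
  have h2 : Summable ((fun x : W ⊕ V => Sum.elim T S x σ i j) ∘ Sum.inr) := by
    simpa only [Function.comp_def, Sum.elim_inr] using hS.summable hw hR hσ i j
  rw [Summable.tsum_sum h1 h2]
  simp only [Sum.elim_inl, Sum.elim_inr]

/-- The constants of the sum family sum to `Σρ + Σρ′`. [folklore] -/
theorem tsum_sum_elim (hT : TermData κ d R T m ρw) (hS : TermData κ d R S m' ρv) :
    ∑' x, Sum.elim ρw ρv x = ∑' w, ρw w + ∑' v, ρv v := by
  rw [Summable.tsum_sum (by simpa only [Sum.elim_comp_inl] using hT.hρw)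
    (by simpa only [Sum.elim_comp_inr] using hS.hρw)]
  simp only [Sum.elim_inl, Sum.elim_inr]

end SumFamily

section Smul

variable {T : W → ℂ → Matrix n n ℂ} {m : W → n → n → ℝ} {ρw : W → ℝ}

/-- **Scalar multiple by a scalar of modulus `≤ X`**: majorant and constants scale by `X` — NOT by the scalar, so
that a family of scalars on a compact range (B10 (63): `x ∈ [0, 2γ₁]`) has ONE set of data (x-UNIFORMITY). [folklore] -/
theorem TermData.smul (h : TermData κ d R T m ρw) {c : ℂ} {X : ℝ} (hc : ‖c‖ ≤ X) :
    TermData κ d R (fun w σ => c • T w σ) (fun w i j => X * m w i j) (fun w => X * ρw w) where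
  ha w i j := by
    simp only [Matrix.smul_apply, smul_eq_mul]
    exact (h.ha w i j).const_mul c
  hm w σ hσ i j := by
    rw [Matrix.smul_apply, smul_eq_mul, norm_mul]
    exact mul_le_mul hc (h.hm w σ hσ i j) (norm_nonneg _) ((norm_nonneg c).trans hc)
  hrow w i := by
    have hX : 0 ≤ X := (norm_nonneg c).trans hc
    calc ∑ j, X * m w i j * Real.exp (κ * d i j) = X * ∑ j, m w i j * Real.exp (κ * d i j) := by
          rw [Finset.mul_sum]; exact Finset.sum_congr rfl fun j _ => by ring
      _ ≤ X * ρw w := mul_le_mul_of_nonneg_left (h.hrow w i) hX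
  hρw := h.hρw.mul_left X

omit [Fintype n] in
/-- The summed operator of the scaled family is the scaled summed operator. [folklore] -/
theorem termSum_smul (T : W → ℂ → Matrix n n ℂ) (c : ℂ) (σ : ℂ) :
    termSum (fun w σ => c • T w σ) σ = c • termSum T σ := by
  ext i j
  simp only [termSum, Matrix.smul_apply, smul_eq_mul]
  exact tsum_mul_left

end Smul

section Prod

variable {T : W → ℂ → Matrix n n ℂ} {m : W → n → n → ℝ} {ρw : W → ℝ}
  {S : V → ℂ → Matrix n n ℂ} {m' : V → n → n → ℝ} {ρv : V → ℝ}

/-- The PRODUCT family: index `W × V`, term `T_w(σ)·S_v(σ)` ([II] p. 3 (1.6): a term of an expansion of a product of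
expanded operators is a product of terms; [13] p. 432). [cite: Balaban1988RG2Cluster, (1.6) p.3] -/
def prodTerm (T : W → ℂ → Matrix n n ℂ) (S : V → ℂ → Matrix n n ℂ) : W × V → ℂ → Matrix n n ℂ :=
  fun p σ => T p.1 σ * S p.2 σ

/-- The product majorant `Σ_k m_w(i,k)·m′_v(k,j)`. [folklore] -/
def prodMaj (m : W → n → n → ℝ) (m' : V → n → n → ℝ) : W × V → n → n → ℝ :=
  fun p i j => ∑ k, m p.1 i k * m' p.2 k j

/-- The product constants `ρ_w·ρ′_v`. [folklore] -/
def prodConst (ρw : W → ℝ) (ρv : V → ℝ) : W × V → ℝ := fun p => ρw p.1 * ρv p.2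

/-- Entries of a product term. [folklore] -/
@[simp] theorem prodTerm_apply (T : W → ℂ → Matrix n n ℂ) (S : V → ℂ → Matrix n n ℂ) (p : W × V) (σ : ℂ) :
    prodTerm T S p σ = T p.1 σ * S p.2 σ := rfl

/-- Entries of the product majorant. [folklore] -/
@[simp] theorem prodMaj_apply (m : W → n → n → ℝ) (m' : V → n → n → ℝ) (p : W × V) (i j : n) :
    prodMaj m m' p i j = ∑ k, m p.1 i k * m' p.2 k j := rfl

omit [Fintype n] in
/-- The product constants. [folklore] -/
@[simp] theorem prodConst_apply (ρw : W → ℝ) (ρv : V → ℝ) (p : W × V) :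
    prodConst ρw ρv p = ρw p.1 * ρv p.2 := rfl

/-- **PRODUCTS of walk-term families carry term data**: analyticity of the entries of `T_w(σ)S_v(σ)` (finite sums of
products), the majorant `Σ_k m_w(i,k)m′_v(k,j)`, its localised row sums `≤ ρ_wρ′_v` by the TRIANGLE INEQUALITY
`d(i,j) ≤ d(i,k) + d(k,j)` and `κ ≥ 0` (the walk distance of a concatenated walk — the mechanism of
`B13PerturbativeStep.wrs_mul_le`, here termwise), and `Summable (ρ_wρ′_v)` over `W × V`. [folklore] -/
theorem TermData.prod [Nonempty n] (hT : TermData κ d R T m ρw) (hS : TermData κ d R S m' ρv)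
    (hw : WeightHyp κ d) (hR : 0 < R) :
    TermData κ d R (prodTerm T S) (prodMaj m m') (prodConst ρw ρv) where
  ha p i j := by
    simp only [prodTerm_apply, Matrix.mul_apply]
    exact DifferentiableOn.fun_sum fun k _ => (hT.ha p.1 i k).mul (hS.ha p.2 k j)
  hm p σ hσ i j := by
    rw [prodTerm_apply, Matrix.mul_apply, prodMaj_apply]
    exact (norm_sum_le _ _).trans (Finset.sum_le_sum fun k _ => (norm_mul_le _ _).trans
      (mul_le_mul (hT.hm p.1 σ hσ i k) (hS.hm p.2 σ hσ k j) (norm_nonneg _) (hT.m_nonneg hR p.1 i k)))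
  hrow p i := by
    have hk : ∀ k j, Real.exp (κ * d i j) ≤ Real.exp (κ * d i k) * Real.exp (κ * d k j) := fun k j => by
      rw [← Real.exp_add]
      exact Real.exp_le_exp.2 (by nlinarith [hw.tri i k j, hw.κ_nonneg])
    calc ∑ j, prodMaj m m' p i j * Real.exp (κ * d i j)
        ≤ ∑ j, ∑ k, m p.1 i k * Real.exp (κ * d i k) * (m' p.2 k j * Real.exp (κ * d k j)) := by
          refine Finset.sum_le_sum fun j _ => ?_
          rw [prodMaj_apply, Finset.sum_mul]
          refine Finset.sum_le_sum fun k _ => ?_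
          calc m p.1 i k * m' p.2 k j * Real.exp (κ * d i j)
              ≤ m p.1 i k * m' p.2 k j * (Real.exp (κ * d i k) * Real.exp (κ * d k j)) :=
                mul_le_mul_of_nonneg_left (hk k j)
                  (mul_nonneg (hT.m_nonneg hR p.1 i k) (hS.m_nonneg hR p.2 k j))
            _ = _ := by ring
      _ = ∑ k, m p.1 i k * Real.exp (κ * d i k) * ∑ j, m' p.2 k j * Real.exp (κ * d k j) := by
          rw [Finset.sum_comm]
          exact Finset.sum_congr rfl fun k _ => (Finset.mul_sum _ _ _).symm
      _ ≤ ∑ k, m p.1 i k * Real.exp (κ * d i k) * ρv p.2 :=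
          Finset.sum_le_sum fun k _ => mul_le_mul_of_nonneg_left (hS.hrow p.2 k)
            (mul_nonneg (hT.m_nonneg hR p.1 i k) (Real.exp_pos _).le)
      _ = (∑ k, m p.1 i k * Real.exp (κ * d i k)) * ρv p.2 := (Finset.sum_mul _ _ _).symm
      _ ≤ ρw p.1 * ρv p.2 := mul_le_mul_of_nonneg_right (hT.hrow p.1 i) (hS.ρw_nonneg hR p.2)
      _ = prodConst ρw ρv p := rfl
  hρw := hT.hρw.mul_of_nonneg hS.hρw (fun w => hT.ρw_nonneg hR w) (fun v => hS.ρw_nonneg hR v)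

/-- The product constants sum to the product of the sums: `Σ_{(w,v)} ρ_wρ′_v = (Σρ)(Σρ′)`. [folklore] -/
theorem tsum_prodConst [Nonempty n] (hT : TermData κ d R T m ρw) (hS : TermData κ d R S m' ρv)
    (hR : 0 < R) :
    ∑' p, prodConst ρw ρv p = (∑' w, ρw w) * ∑' v, ρv v := by
  simp only [prodConst]
  exact (tsum_mul_tsum_of_summable_norm (hT.summable_norm_ρw hR) (hS.summable_norm_ρw hR)).symm

/-- Hence `Σ_{(w,v)} ρ_wρ′_v ≤ ρρ′` whenever `Σρ ≤ ρ`, `Σρ′ ≤ ρ′`. [folklore] -/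
theorem tsum_prodConst_le [Nonempty n] (hT : TermData κ d R T m ρw) (hS : TermData κ d R S m' ρv)
    (hR : 0 < R) {ρ ρ' : ℝ} (hρ : ∑' w, ρw w ≤ ρ) (hρ' : ∑' v, ρv v ≤ ρ') :
    ∑' p, prodConst ρw ρv p ≤ ρ * ρ' := by
  rw [tsum_prodConst hT hS hR]
  exact mul_le_mul hρ hρ' (hS.tsum_ρw_nonneg hR) ((hT.tsum_ρw_nonneg hR).trans hρ)

/-- **The Cauchy product, entrywise**: for two families with absolutely summable entries the entrywise sum of the
product family is the product of the entrywise sums (Mathlib `tsum_mul_tsum_of_summable_norm` + interchange with the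
finite sum over the middle index). [folklore] -/
theorem tsum_mul_apply_of_summable_norm {A : W → Matrix n n ℂ} {B : V → Matrix n n ℂ}
    (hA : ∀ i j, Summable fun w => ‖A w i j‖) (hB : ∀ i j, Summable fun v => ‖B v i j‖) (i j : n) :
    ∑' p : W × V, (A p.1 * B p.2) i j = ∑ k, (∑' w, A w i k) * ∑' v, B v k j := by
  simp only [Matrix.mul_apply]
  rw [Summable.tsum_finsetSum (fun k _ => summable_mul_of_summable_norm (hA i k) (hB k j))]
  exact Finset.sum_congr rfl fun k _ => (tsum_mul_tsum_of_summable_norm (hA i k) (hB k j)).symm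

/-- **`termSum` IS MULTIPLICATIVE on the disc**: `termSum (prodTerm T S) σ = termSum T σ * termSum S σ` — the
expansion of a product of expanded operators ([13] p. 432: *"Expanding these into random walks we get a random walk
expansion of C^{(k)}(Λ)"*). [cite: Balaban1985BackgroundPropagators, p.432 after (3.186)] -/
theorem termSum_prod (hT : TermData κ d R T m ρw) (hS : TermData κ d R S m' ρv) (hw : WeightHyp κ d)
    (hR : 0 < R) {σ : ℂ} (hσ : σ ∈ ball (0 : ℂ) R) :
    termSum (prodTerm T S) σ = termSum T σ * termSum S σ := by
  ext i j
  have h := tsum_mul_apply_of_summable_norm (A := fun w => T w σ) (B := fun v => S v σ)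
    (fun i k => hT.summable_norm hw hR hσ i k) (fun k j => hS.summable_norm hw hR hσ k j) i j
  simp only [termSum, prodTerm_apply, Matrix.mul_apply] at h ⊢
  exact h

end Prod

/-! ## §3 Monomial decorations compose -/

section Mono

omit [Fintype n]

/-- **Products of monomially decorated terms are monomially decorated, degrees ADDING**:
`(a_wσ^{e_w}•K_w)(a′_vσ^{e′_v}•K′_v) = (a_wa′_v)σ^{e_w+e′_v}•(K_wK′_v)` ([II] p. 13 «introduced into the operators as
before»; products of `k` decorated propagators have degree `≤ k`, `AnalyticWalkSum216Monomial` §3).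
[cite: Balaban1988RG2Cluster, p.13 before (2.7)] -/
theorem prodTerm_monoTerm [Fintype n] (a : W → ℂ) (e : W → ℕ) (K : W → Matrix n n ℂ) (a' : V → ℂ) (e' : V → ℕ)
    (K' : V → Matrix n n ℂ) :
    prodTerm (monoTerm a e K) (monoTerm a' e' K') =
      monoTerm (fun p : W × V => a p.1 * a' p.2) (fun p => e p.1 + e' p.2) (fun p => K p.1 * K' p.2) := by
  funext p σ
  simp only [prodTerm, monoTerm, Matrix.smul_mul, Matrix.mul_smul, smul_smul, pow_add]
  congr 1
  ring

end Mono

/-! ## §4 Non-vacuity -/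

/-- The hypothesis structure is inhabited: one bond, one walk, `T(σ) = σ` on the unit disc, majorant `1`, trivial
distance, constant `1`. [folklore] -/
theorem termData_example : TermData (n := Unit) (W := Unit) 0 (fun _ _ => 0) 1 (fun _ σ => fun _ _ => σ)
    (fun _ _ _ => 1) (fun _ => 1) where
  ha _ _ _ := differentiableOn_id
  hm _ σ hσ _ _ := (mem_ball_zero_iff.1 hσ).le
  hrow _ _ := by simp
  hρw := .of_finite

end

end Summit.QuantumFields.BalabanUV.Beta.AnalyticWalkSum216Algebra
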